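import Mathlib
import Summits.CriticalPhenomena.PercolationContinuityZ3.Theorems.PercNearOneGluingNoHeavyLowerTailOrderedDifferences

/-!
# Ordered Marica–Schönheim: the incidence rows are linearly INDEPENDENT (rank certificates for MS and `MS2′`)

Helper file for crux `stmt-CriticalPhenomena-4575` (`NoHeavyLowerTail`, route `PercNearOneGluingNoHeavy`),
new-inequality factory seat `prim-ineq-gen-3` (gen 18).  Everything here is PROVED; no definitions.

`OrderedDifferences.card_le_card_of_rank` (gen 5) proves the counting statement `card ι ≤ #T` by a Möbius-weighted rank
argument.  Gen 18's CONJECTURE `R3±` / `R3±-W2` (memo `run/shared/lean/prim/prim-ineq-gen-3/CONJECTURE-G3.md` §3, §5) is phrased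
in terms of LINEAR INDEPENDENCE of the plain 0/1 incidence rows `E ↦ [E ⊆ A i]` over the target family, consumed by the rank socket
`OrientedAntipodalHall.card_le_card_wordsTwo_of_rankCert`.  This file upgrades the gen-5 theorem to that form:

* `linearIndependent_incidence_of_rank` — under the hypotheses of `card_le_card_of_rank` (a rank function `r` into a linear order,
  `A i ⊄ A j` for `i ≠ j` with `r i ≤ r j`, and `A i \ A j ∈ T` whenever `r i ≤ r j`) the rows `i ↦ (E ↦ [E ⊆ A i])`, `E ∈ T`, are
  linearly independent over `ℚ`.  [Same matrices as gen 5: `P = U · diag μ` with `P Q` unitriangular, so `card ι = rank P ≤ rank U`.]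
* `linearIndependent_incidence_diffs` — Marica–Schönheim as a rank certificate: for any family `𝒜` the rows `[E ⊆ A]`, `A ∈ 𝒜`,
  over `𝒜 \\ 𝒜` are independent (all members PLAIN: `R3±` for one type).
* `linearIndependent_incidence_diffs_union` — `MS2′` as a rank certificate: if no member of `𝒞` lies in a member of `ℬ`, the rows of
  `𝒞 ∪ ℬ` over `(𝒞 \\ 𝒞) ∪ (𝒞 \\ ℬ) ∪ (ℬ \\ ℬ)` are independent (`𝒞` = members of one class PLAIN, `ℬ` = bads of the other class,
  i.e. those members COMPLEMENTED: `R3±` for a 2-path / for the two outer families of `MS3′`).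
So CONJECTURE `R3±` holds for at most two classes; the three-class case (`MS3′`) is open (gen 18: it holds in every instance tested,
but no type-constant sign rule survives — memo §5b).
(prim-ineq-gen-3 gen 18, 2026-08-23.)
-/

namespace Summit.CriticalPhenomena.PercolationContinuityZ3.Theorems

namespace OrderedDifferences

open Finset Matrix
open scoped FinsetFamily

variable {α : Type*} [DecidableEq α]

/-- **Ordered Marica–Schönheim, independence form.**  Under the hypotheses of `card_le_card_of_rank`, the plain incidence rows
`i ↦ (E ↦ [E ⊆ A i])` over `T` are linearly independent over `ℚ`. -/
theorem linearIndependent_incidence_of_rank {ι β : Type*} [Fintype ι] [DecidableEq ι] [LinearOrder β]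
    (A : ι → Finset α) (r : ι → β) (hA : ∀ ⦃i j : ι⦄, i ≠ j → r i ≤ r j → ¬ A i ⊆ A j)
    (T : Finset (Finset α)) (hT : ∀ ⦃i j : ι⦄, r i ≤ r j → A i \ A j ∈ T) :
    LinearIndependent ℚ (fun i : ι => fun E : T => if (E : Finset α) ⊆ A i then (1 : ℚ) else 0) := by
  classical
  obtain ⟨μ, hμ⟩ := exists_moebius_weights T
  have key : ∀ i j : ι, r i ≤ r j →
      ∑ E ∈ T.filter (· ⊆ A i \ A j), μ E = if i = j then 1 else 0 := by
    intro i j hij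
    rw [hμ _ (hT hij)]
    by_cases h : i = j
    · subst h
      simp
    · have hne : A i \ A j ≠ ∅ := fun h0 => hA h hij (sdiff_eq_empty_iff_subset.mp h0)
      simp [h, hne]
  -- the three matrices: plain incidence `U`, Möbius-weighted `P = U * diagonal μ`, tests `Q`
  let U : Matrix ι T ℚ := fun i E => if (E : Finset α) ⊆ A i then 1 else 0
  let P : Matrix ι T ℚ := fun i E => if (E : Finset α) ⊆ A i then μ E else 0
  let Q : Matrix T ι ℚ := fun E j => if Disjoint (E : Finset α) (A j) then 1 else 0
  have hPU : P = U * Matrix.diagonal (fun E : T => μ E) := by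
    ext i E
    rw [Matrix.mul_diagonal]
    by_cases h : (E : Finset α) ⊆ A i <;> simp [U, P, h]
  have hPQ : ∀ i j, (P * Q) i j = ∑ E ∈ T.filter (· ⊆ A i \ A j), μ E := by
    intro i j
    rw [Matrix.mul_apply]
    have h1 : ∑ E : T, P i E * Q E j =
        ∑ E ∈ T, (if E ⊆ A i then μ E else 0) * (if Disjoint E (A j) then 1 else 0) :=
      Finset.sum_coe_sort T (fun E => (if E ⊆ A i then μ E else 0) *
        (if Disjoint E (A j) then 1 else 0))
    rw [h1, sum_filter]
    refine sum_congr rfl fun E _ => ?_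
    by_cases ha : E ⊆ A i <;> by_cases hb : Disjoint E (A j) <;> simp [ha, hb, subset_sdiff]
  have hzero : ∀ i j : ι, i ≠ j → r i ≤ r j → (P * Q) i j = 0 := by
    intro i j hij hr
    rw [hPQ, key i j hr, if_neg hij]
  have hone : ∀ i : ι, (P * Q) i i = 1 := by
    intro i
    rw [hPQ, key i i le_rfl, if_pos rfl]
  have hBT : (P * Q).BlockTriangular (OrderDual.toDual ∘ r) := by
    intro i j hij
    have hij' : r i < r j := hij
    exact hzero i j (fun h => by subst h; exact lt_irrefl _ hij') hij'.le
  have hdet : (P * Q).det = 1 := by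
    rw [hBT.det]
    refine prod_eq_one fun a _ => ?_
    have hblock : (P * Q).toSquareBlock (OrderDual.toDual ∘ r) a = 1 := by
      ext ⟨i, hi⟩ ⟨j, hj⟩
      rw [toSquareBlock_def, of_apply]
      by_cases h : i = j
      · subst h
        rw [hone, one_apply_eq]
      · have hr : r i = r j := by
          have h1 : OrderDual.toDual (r i) = a := hi
          have h2 : OrderDual.toDual (r j) = a := hj
          exact OrderDual.toDual.injective (h1.trans h2.symm)
        rw [hzero i j h hr.le, one_apply_ne (fun h' => h (Subtype.ext_iff.mp h'))]
    rw [hblock, det_one]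
  have hunit : IsUnit (P * Q) := by
    rw [Matrix.isUnit_iff_isUnit_det, hdet]
    exact isUnit_one
  -- rank bookkeeping: card ι = rank (P Q) ≤ rank P ≤ rank U ≤ card ι
  have hrankU : U.rank = Fintype.card ι := by
    apply le_antisymm (rank_le_card_height U)
    calc Fintype.card ι = (P * Q).rank := (rank_of_isUnit _ hunit).symm
      _ ≤ P.rank := rank_mul_le_left P Q
      _ = (U * Matrix.diagonal (fun E : T => μ E)).rank := by rw [hPU]
      _ ≤ U.rank := rank_mul_le_left _ _
  -- independence of the rows of `U`
  have hli : LinearIndependent ℚ U.row := by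
    rw [linearIndependent_iff_card_eq_finrank_span, Set.finrank, ← Matrix.rank_eq_finrank_span_row, hrankU]
  exact hli

/-- **Marica–Schönheim as a rank certificate (one class, all members plain).**  For every finite family `𝒜` of finite sets the
incidence rows `A ↦ (E ↦ [E ⊆ A])` over the difference family `𝒜 \\ 𝒜` are linearly independent over `ℚ`. -/
theorem linearIndependent_incidence_diffs (𝒜 : Finset (Finset α)) :
    LinearIndependent ℚ (fun A : 𝒜 => fun E : (𝒜 \\ 𝒜 : Finset (Finset α)) =>
      if (E : Finset α) ⊆ (A : Finset α) then (1 : ℚ) else 0) := by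
  classical
  refine linearIndependent_incidence_of_rank (ι := ↥𝒜) (fun A => (A : Finset α)) (fun A => -(#(A : Finset α) : ℤ))
    ?_ (𝒜 \\ 𝒜) ?_
  · rintro ⟨X, hX⟩ ⟨Y, hY⟩ hne hr hXY
    simp only at hr hXY
    have hle : #Y ≤ #X := by omega
    exact hne (Subtype.ext (eq_of_subset_of_card_le hXY hle))
  · rintro ⟨X, hX⟩ ⟨Y, hY⟩ -
    exact mem_diffs.mpr ⟨X, hX, Y, hY, rfl⟩

/-- **`MS2′` as a rank certificate (two classes: `𝒞` plain, `ℬ` = the complemented second class).**  If no member of `𝒞` is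
contained in a member of `ℬ`, the incidence rows of `𝒞 ∪ ℬ` over `(𝒞 \\ 𝒞) ∪ (𝒞 \\ ℬ) ∪ (ℬ \\ ℬ)` are linearly independent. -/
theorem linearIndependent_incidence_diffs_union (𝒞 ℬ : Finset (Finset α))
    (h : ∀ C ∈ 𝒞, ∀ B ∈ ℬ, ¬ C ⊆ B) :
    LinearIndependent ℚ (fun X : (𝒞 ∪ ℬ : Finset (Finset α)) =>
      fun E : ((𝒞 \\ 𝒞) ∪ (𝒞 \\ ℬ) ∪ (ℬ \\ ℬ) : Finset (Finset α)) =>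
        if (E : Finset α) ⊆ (X : Finset α) then (1 : ℚ) else 0) := by
  classical
  have hdisj : Disjoint 𝒞 ℬ := by
    rw [Finset.disjoint_left]
    intro X hXC hXB
    exact h X hXC X hXB subset_rfl
  set K : ℕ := (𝒞 ∪ ℬ).sup card + 1 with hK
  have hcardK : ∀ X ∈ 𝒞 ∪ ℬ, #X < K := by
    intro X hX
    have := Finset.le_sup (f := card) hX
    omega
  let r : ↥(𝒞 ∪ ℬ) → ℤ := fun X => (if (X : Finset α) ∈ ℬ then (K : ℤ) else 0) - (#(X : Finset α) : ℤ)
  refine linearIndependent_incidence_of_rank (ι := ↥(𝒞 ∪ ℬ)) (fun X => (X : Finset α)) r ?_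
    ((𝒞 \\ 𝒞) ∪ (𝒞 \\ ℬ) ∪ (ℬ \\ ℬ)) ?_
  · rintro ⟨X, hX⟩ ⟨Y, hY⟩ hne hr hXY
    simp only [ne_eq, Subtype.mk.injEq] at hne
    simp only [r] at hr
    have hXK := hcardK X hX
    have hYK := hcardK Y hY
    rcases mem_union.mp hX with hXC | hXB <;> rcases mem_union.mp hY with hYC | hYB
    · rw [if_neg (Finset.disjoint_left.mp hdisj hXC), if_neg (Finset.disjoint_left.mp hdisj hYC)] at hr
      have hle : #Y ≤ #X := by omega
      exact hne (eq_of_subset_of_card_le hXY hle)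
    · exact h X hXC Y hYB hXY
    · rw [if_pos hXB, if_neg (Finset.disjoint_left.mp hdisj hYC)] at hr
      omega
    · rw [if_pos hXB, if_pos hYB] at hr
      have hle : #Y ≤ #X := by omega
      exact hne (eq_of_subset_of_card_le hXY hle)
  · rintro ⟨X, hX⟩ ⟨Y, hY⟩ hr
    simp only [r] at hr
    have hXK := hcardK X hX
    have hYK := hcardK Y hY
    simp only [mem_union, mem_diffs]
    rcases mem_union.mp hX with hXC | hXB <;> rcases mem_union.mp hY with hYC | hYB
    · exact Or.inl (Or.inl ⟨X, hXC, Y, hYC, rfl⟩)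
    · exact Or.inl (Or.inr ⟨X, hXC, Y, hYB, rfl⟩)
    · rw [if_pos hXB, if_neg (Finset.disjoint_left.mp hdisj hYC)] at hr
      omega
    · exact Or.inr ⟨X, hXB, Y, hYB, rfl⟩

end OrderedDifferences

end Summit.CriticalPhenomena.PercolationContinuityZ3.Theorems
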